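import Literature.MathematicalPhysics.QuantumFieldTheory.Balaban1983to89.B9Eq326DeltaABlockDecayTowerTwoBackgrounds
import Literature.MathematicalPhysics.QuantumFieldTheory.Balaban1983to89.B9Eq325RLipschitzSqrtTowerTwoBackgroundsLinear
import Literature.MathematicalPhysics.QuantumFieldTheory.Balaban1983to89.B9Eq315QTowerLipschitzL2TwoBackgroundsChain

/-!
# `Balaban1983to89.B9Eq326DeltaABlockDecayTowerTwoBackgroundsLipschitz` — T. Bałaban, *Propagators for lattice gauge theories in a background field*, Commun.
# Math. Phys. **99** (1985) 389–434 [Balaban1985BackgroundPropagators] (3.26) p. 395, (3.25) p. 394, (3.15)–(3.16) p. 393, Thm 3.4 p. 400, (3.86) p. 407,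
# Thm 3.11 p. 416: **THE BIG-BLOCK `L²` DECAY OF `G₁,k(V) − G₁,k(U)` WITH THE TWO LIPSCHITZ LETTERS `e_R`, `e_Q` DISCHARGED TO THE TREE** — the `uR` ∕ `uQ`
# sockets of `B9Eq326DeltaABlockDecayTowerTwoBackgrounds.norm_block_G1k_sub_G1k_le` supplied BY NAME by
# `B9Eq325RLipschitzSqrtTowerTwoBackgroundsLinear.norm_RofUk_sub_RofUk_le_diagonal_global` (`e_R := max(3s_A⁽²⁾∕s_V, 2∕δ₀)·δ`, every `δ ≥ 0`) and
# `B9Eq315QTowerLipschitzL2TwoBackgroundsChain.norm_QkW_sub_QkW_le_L2_linear` (`e_Q := M_φ′M_φ√(c₁∕(c₀L^{kd}))·2e^{K_Aα_b∕(1−r_p)}·(K_B∕(1−r_p))·δ`)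

statement-level skeleton of published theorems with citation tags; proofs where landed; nothing here is a claim about the Yang–Mills mass gap

PDF held: `paper:balaban1985-cmp99-background-propagators` (journal page = PDF page + 388); (3.25)∕(3.26) pp. 394–395, (3.86) p. 407 read through the suppliers.

CITATION HEADER (lean-in-tree rule 2026-08-18).  Audit cell `pub-balaban`, sub-cell `t4`, NE9 crux team (2): LEAF PROVER 01 (`b2b-balaban-t4-ne9-formalise-leaf-01`
gen 88), I-12 of the N52 road (α) batch (t4-ne9-idea-1 g151 N52, journal l.62985: «lattice junction = (CDT)'s binders ×2 + (T4) closeness letters»).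
WHY: after I-9 (`e₁`, `e₂` ← bond closeness), I-10 (`δ₁`, `δ₂` ← «conjugate the difference») and I-11 (the read-out), the two remaining ZEROTH-order
two-background letters `e_R` (the `R_k` Lipschitz letter) and `e_Q` (the `Q_k` Lipschitz letter) have TREE suppliers LINEAR in the closeness; this file
plugs them in, so that the block-decay constant's dependence on the two backgrounds is through `δ` (bond closeness), the level profiles `ε_j ≤ α_b r_p^j`,
`δ_j ≤ δ r_p^j`, and the three still-DISPLAYED conjugated letters `δ_R`, `δ_Q`, `δ_K` (other lineages' files: (PDC) two backgrounds; the `Q_k` ∕ `Q_k^*`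
conjugated pair; ne9-leaf-04 g81's `B9Eq369CurvFormConjugationTwoBackgrounds` for `δ_K`) + (CDT)'s single-background letters at `U` and at `V`.

WHAT IS PROVED (sorry-free; 0 `def`; [folklore] composition BY NAME; nothing of [B9] asserted as printed).
* **`norm_block_G1k_sub_G1k_le_lipschitz`** — `B9Eq326DeltaABlockDecayTowerTwoBackgrounds.norm_block_G1k_sub_G1k_le` with `uR`, `uQ` supplied:
  `‖P_{y₁} ∘ (G₁,k(V) − G₁,k(U)) ∘ P_{y₀}‖ ≤ C·e^{r}·e^{−r·d_m(y₀,y₁)}`, `C` = I-11's constant at the two explicit Lipschitz letters above.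
MODEL ∕ DECLARED READINGS.  Those of the three imported files: the binders of I-11 §2 verbatim (minus `e_R`, `e_Q`, `uR`, `uQ`), plus the profile ∕ window
binders of the two suppliers with the clashing names renamed (`α_b` = bond smallness real, vs the `Q_k`-regularity profile `α : ℕ → ℝ`; `γ_R` = (3.25)'s
constant, vs the coercivity `γ`; `r_p` = profile ratio, vs the circle radius `r`; `hwinR` ∕ `hwinQ`); the `Q_k` supplier is used at `α′ := α`, `ε_s := α_b`,
`δ_s := δ`.  NO `η⁻¹`, NO volume, NO number of levels in the constant.
HONEST SCOPE.  [folklore] term-mode junction (two `fun s => thm … s` + one `exact`); ONE route sub-step's bookkeeping; «NE9 ⇐ the named binders»; NE9 NOT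
PRINTED ∕ NOT PROVED; NOT summit progress (cell pub-balaban: row NE9 WALLED ON A MODEL (O-NE9-1; #5 UNRULED); spine PROVED 0∕9; rung (B)+1 finite T⁴ — NOT
infinite volume, NOT mass gap, NOT BetaPertH, NOT Clay; HONEST DEPENDENCY: continuum YM on T⁴ ⇐ BetaPertH ∧ nine spine estimates (0/9 proved); BetaPertH ⇐
(D1) ∧ (D4) ∧ CAP+tail; G-an2-4 gates asym, D1 and NE2/3/4).  NEW file; nothing modified.  Net new unproved facts: 0.
-/

noncomputable section

open scoped InnerProductSpace ComplexConjugate BigOperators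
open NormedSpace

namespace Literature.MathematicalPhysics.QuantumFieldTheory.Balaban1983to89.B9Eq326DeltaABlockDecayTowerTwoBackgroundsLipschitz

open B4Sect5Torus (TSite tdist)
open B9SectCLatticeCarrier (Bond bpos btgt)
open B9Eq311L2Pairing (WL2)
open B9Eq319QprimeTorus (blockCoord)
open B9Eq315QTower (towerP)
open B9Eq315QTorus (perCfg cornerSite)
open B7Prop1Explicit (Wcx boxVec)
open B9Eq316TowerFlatIsOneStep (siteCast siteCast_rfl towerP_eq_fineP_pow)
open B7Prop1Explicit (U1)
open B11Eq103H1Complex (SiteL2K BondL2K covDivL2K)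
open B9Eq310HessianOperator (adTransportW PlaqL2K curvOp)
open B9Eq326OperatorTower (laplaceAk RofUk G1k QkW)
open B9Eq326DeltaABlockDecayTowerTwoBackgrounds (norm_block_G1k_sub_G1k_le)
open B9Eq325RLipschitzSqrtTowerTwoBackgroundsLinear (norm_RofUk_sub_RofUk_le_diagonal_global)
open B9Eq315QTowerLipschitzL2TwoBackgroundsChain (norm_QkW_sub_QkW_le_L2_linear)

variable {d : ℕ} {L : ℕ} [NeZero L] {m : Fin d → ℕ} [∀ i, NeZero (m i)] {n : ℕ}
  {𝔸 : Type*} [NormedRing 𝔸] [StarRing 𝔸] [NormedAlgebra ℂ 𝔸] [StarModule ℂ 𝔸] [CompleteSpace 𝔸] [NormOneClass 𝔸]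
  {W : Type*} [NormedAddCommGroup W] [InnerProductSpace ℂ W] [FiniteDimensional ℂ W] (φ : W ≃ₗ[ℂ] 𝔸) {Mφ Mφ' : ℝ}
  (hφ : ∀ w, ‖φ w‖ ≤ Mφ * ‖w‖) (hφ' : ∀ X, ‖φ.symm X‖ ≤ Mφ' * ‖X‖) (hMφ : 0 ≤ Mφ) (hMφ' : 0 ≤ Mφ')
  {c₀ : ℝ} [Fact (0 < c₀)] {c₁ : ℝ} [Fact (0 < c₁)] {η : ℝ} (hη : 0 < η) (hηL : η * (L : ℝ) ^ (n + 1) = 1)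
  (U V : Bond d (towerP L m (n + 1)) → 𝔸ˣ) (hU : ∀ b, U b ∈ U1 𝔸) (hV : ∀ b, V b ∈ U1 𝔸)
  (hRSU : ∀ (b : Bond d (towerP L m (n + 1))) (v u : W), ⟪adTransportW φ U b v, u⟫_ℂ = ⟪v, adTransportW φ (fun b => (U b)⁻¹) b u⟫_ℂ)
  (hRSV : ∀ (b : Bond d (towerP L m (n + 1))) (v u : W), ⟪adTransportW φ V b v, u⟫_ℂ = ⟪v, adTransportW φ (fun b => (V b)⁻¹) b u⟫_ℂ)
  (τ : 𝔸 →ₗ[ℂ] ℂ) (hL : 1 ≤ L) (α : ℕ → ℝ) (hα1 : ∀ j, α j ≤ 1 / 64)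
  (hU1U : ∀ (j : ℕ) (x : B7Prop1Explicit.Site d) (κ : Fin d), perCfg (towerP L m (j + 1)) (B9Eq315QTower.UlevOf L m (n + 1) U j) x κ ∈ U1 𝔸)
  (hregU : ∀ (j : ℕ) (y : TSite d (towerP L m j)) (κ : Fin d) (r : Fin d → Fin L),
    ‖((Wcx L (perCfg (towerP L m (j + 1)) (B9Eq315QTower.UlevOf L m (n + 1) U j)) (cornerSite L y) κ (boxVec L r) : 𝔸ˣ) : 𝔸) - 1‖ ≤ α j)
  (hU1V : ∀ (j : ℕ) (x : B7Prop1Explicit.Site d) (κ : Fin d), perCfg (towerP L m (j + 1)) (B9Eq315QTower.UlevOf L m (n + 1) V j) x κ ∈ U1 𝔸)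
  (hregV : ∀ (j : ℕ) (y : TSite d (towerP L m j)) (κ : Fin d) (r : Fin d → Fin L),
    ‖((Wcx L (perCfg (towerP L m (j + 1)) (B9Eq315QTower.UlevOf L m (n + 1) V j)) (cornerSite L y) κ (boxVec L r) : 𝔸ˣ) : 𝔸) - 1‖ ≤ α j)
  (a : ℝ)

include hφ hφ' hMφ hMφ' hη hηL hU hV hRSU hRSV in
/-- **THE BIG-BLOCK `L²` DECAY OF `G₁,k(V) − G₁,k(U)` WITH `e_R`, `e_Q` DISCHARGED**: `B9Eq326DeltaABlockDecayTowerTwoBackgrounds.norm_block_G1k_sub_G1k_le`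
(every binder of it kept verbatim except the two Lipschitz letters) with `uR` ← `norm_RofUk_sub_RofUk_le_diagonal_global` (`e_R = max(3s_A⁽²⁾∕s_V, 2∕δ₀)·δ`)
and `uQ` ← `norm_QkW_sub_QkW_le_L2_linear` at `α′ := α`, `ε_s := α_b`, `δ_s := δ` (`e_Q ∝ δ`), under those files' profile ∕ window binders (renamed
`α_b, γ_R, r_p, hwinR, hwinQ`).  Displayed: (CDT)'s letters twice, `δ_R`, `δ_Q`, `δ_K`. [folklore]
[cite: Balaban1985BackgroundPropagators, (3.26) p.395, (3.25) p.394, (3.15)–(3.16) p.393, Thm 3.4 p.400, (3.86) p.407, Thm 3.11 p.416; Balaban1985Variational, (110) p.294] -/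
theorem norm_block_G1k_sub_G1k_le_lipschitz (ha : 0 ≤ a) (hm : ∀ i, 1 ≤ m i)
    (hposU : ∀ x : BondL2K ℂ d (towerP L m (n + 1)) c₀ W, x ≠ 0 → 0 < RCLike.re ⟪x, laplaceAk L m n φ η U hL α hα1 hU1U hregU τ (c₀ := c₀) (c₁ := c₁) a x⟫_ℂ)
    (hposV : ∀ x : BondL2K ℂ d (towerP L m (n + 1)) c₀ W, x ≠ 0 → 0 < RCLike.re ⟪x, laplaceAk L m n φ η V hL α hα1 hU1V hregV τ (c₀ := c₀) (c₁ := c₁) a x⟫_ℂ)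
    {γ β βK pK ℓ ℓ' r ρ CP : ℝ} (hγ : 0 < γ) (hβ : 0 ≤ β) (hℓ : 1 ≤ ℓ) (hℓ' : 1 ≤ ℓ') (hr : 0 ≤ r) (hρ : 0 ≤ ρ) (hρ8 : ρ ≤ 1 / 8)
    (hCP : 0 ≤ CP)
    (hcoerU : ∀ f : BondL2K ℂ d (towerP L m (n + 1)) c₀ W, γ * ‖f‖ ^ 2 ≤ RCLike.re ⟪f, laplaceAk L m n φ η U hL α hα1 hU1U hregU τ (c₀ := c₀) (c₁ := c₁) a f⟫_ℂ)
    (hcoerV : ∀ f : BondL2K ℂ d (towerP L m (n + 1)) c₀ W, γ * ‖f‖ ^ 2 ≤ RCLike.re ⟪f, laplaceAk L m n φ η V hL α hα1 hU1V hregV τ (c₀ := c₀) (c₁ := c₁) a f⟫_ℂ)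
    (hKreU : ∀ f : BondL2K ℂ d (towerP L m (n + 1)) c₀ W, -(pK * ‖f‖ ^ 2) ≤ RCLike.re ⟪f, curvOp φ τ η U f⟫_ℂ)
    (hKreV : ∀ f : BondL2K ℂ d (towerP L m (n + 1)) c₀ W, -(pK * ‖f‖ ^ 2) ≤ RCLike.re ⟪f, curvOp φ τ η V f⟫_ℂ)
    (hwin : r * ℓ * η ≤ 1)
    (hβCC : 4 * r * ℓ * (Mφ * Mφ') * (d * Real.sqrt d) ≤ β) (hβC : 4 * r * ℓ * (Mφ * Mφ') * d ≤ β)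
    (hβD : 2 * r * ℓ * (Mφ * Mφ') * Real.sqrt d ≤ β)
    (hQKU : ∀ (χ : TSite d (towerP L m (n + 1)) → ℝ) (χ' : TSite d m → ℝ),
      (∀ b : Bond d (towerP L m (n + 1)), |χ (bpos b) - χ (btgt b)| ≤ ℓ * η) →
      (∀ (y : TSite d m) (x : TSite d (towerP L m (n + 1))),
        siteCast (towerP_eq_fineP_pow L m (n + 1)) x ∈ B9Eq319QprimeTorus.blockOf (L ^ (n + 1)) m y → |χ' y - χ x| ≤ ℓ') →
      ∀ (MB : BondL2K ℂ d (towerP L m (n + 1)) c₀ W →L[ℂ] BondL2K ℂ d (towerP L m (n + 1)) c₀ W),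
      (∀ (g : BondL2K ℂ d (towerP L m (n + 1)) c₀ W) (b : Bond d (towerP L m (n + 1))),
        WL2.equiv ℂ (fun _ : Bond d (towerP L m (n + 1)) => c₀) W (MB g) b = (χ (bpos b) : ℂ) • WL2.equiv ℂ (fun _ : Bond d (towerP L m (n + 1)) => c₀) W g b) →
      ∀ (MS : SiteL2K ℂ d (towerP L m (n + 1)) c₀ W →L[ℂ] SiteL2K ℂ d (towerP L m (n + 1)) c₀ W),
      (∀ (g : SiteL2K ℂ d (towerP L m (n + 1)) c₀ W) (x : TSite d (towerP L m (n + 1))),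
        WL2.equiv ℂ (fun _ : TSite d (towerP L m (n + 1)) => c₀) W (MS g) x = (χ x : ℂ) • WL2.equiv ℂ (fun _ : TSite d (towerP L m (n + 1)) => c₀) W g x) →
      ∀ (MF : BondL2K ℂ d m c₁ W →L[ℂ] BondL2K ℂ d m c₁ W),
      (∀ (g : BondL2K ℂ d m c₁ W) (b' : Bond d m),
        WL2.equiv ℂ (fun _ : Bond d m => c₁) W (MF g) b' = (χ' (bpos b') : ℂ) • WL2.equiv ℂ (fun _ : Bond d m => c₁) W g b') →
      ∀ κ : ℂ, ‖κ‖ = r →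
      (∀ f, ‖exp (κ • MF) ((QkW L m n φ U hL α hα1 hU1U hregU (c₀ := c₀) (c₁ := c₁)) (exp (κ • (-MB)) f)) - (QkW L m n φ U hL α hα1 hU1U hregU (c₀ := c₀) (c₁ := c₁)) f‖ ≤ β * ‖f‖) ∧
      (∀ g, ‖exp (κ • MB) (LinearMap.adjoint (QkW L m n φ U hL α hα1 hU1U hregU (c₀ := c₀) (c₁ := c₁)) (exp (κ • (-MF)) g)) - LinearMap.adjoint (QkW L m n φ U hL α hα1 hU1U hregU (c₀ := c₀) (c₁ := c₁)) g‖ ≤ β * ‖g‖) ∧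
      (∀ f, ‖exp (κ • MB) (curvOp φ τ η U (exp (κ • (-MB)) f)) - curvOp φ τ η U f‖ ≤ βK * ‖f‖) ∧
      (∀ s, ‖exp (κ • MS) (RofUk L m n φ η U (c₀ := c₀) (exp (κ • (-MS)) s)) - RofUk L m n φ η U (c₀ := c₀) s‖ ≤ ρ * ‖s‖))
    (hQKV : ∀ (χ : TSite d (towerP L m (n + 1)) → ℝ) (χ' : TSite d m → ℝ),
      (∀ b : Bond d (towerP L m (n + 1)), |χ (bpos b) - χ (btgt b)| ≤ ℓ * η) →
      (∀ (y : TSite d m) (x : TSite d (towerP L m (n + 1))),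
        siteCast (towerP_eq_fineP_pow L m (n + 1)) x ∈ B9Eq319QprimeTorus.blockOf (L ^ (n + 1)) m y → |χ' y - χ x| ≤ ℓ') →
      ∀ (MB : BondL2K ℂ d (towerP L m (n + 1)) c₀ W →L[ℂ] BondL2K ℂ d (towerP L m (n + 1)) c₀ W),
      (∀ (g : BondL2K ℂ d (towerP L m (n + 1)) c₀ W) (b : Bond d (towerP L m (n + 1))),
        WL2.equiv ℂ (fun _ : Bond d (towerP L m (n + 1)) => c₀) W (MB g) b = (χ (bpos b) : ℂ) • WL2.equiv ℂ (fun _ : Bond d (towerP L m (n + 1)) => c₀) W g b) →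
      ∀ (MS : SiteL2K ℂ d (towerP L m (n + 1)) c₀ W →L[ℂ] SiteL2K ℂ d (towerP L m (n + 1)) c₀ W),
      (∀ (g : SiteL2K ℂ d (towerP L m (n + 1)) c₀ W) (x : TSite d (towerP L m (n + 1))),
        WL2.equiv ℂ (fun _ : TSite d (towerP L m (n + 1)) => c₀) W (MS g) x = (χ x : ℂ) • WL2.equiv ℂ (fun _ : TSite d (towerP L m (n + 1)) => c₀) W g x) →
      ∀ (MF : BondL2K ℂ d m c₁ W →L[ℂ] BondL2K ℂ d m c₁ W),
      (∀ (g : BondL2K ℂ d m c₁ W) (b' : Bond d m),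
        WL2.equiv ℂ (fun _ : Bond d m => c₁) W (MF g) b' = (χ' (bpos b') : ℂ) • WL2.equiv ℂ (fun _ : Bond d m => c₁) W g b') →
      ∀ κ : ℂ, ‖κ‖ = r →
      (∀ f, ‖exp (κ • MF) ((QkW L m n φ V hL α hα1 hU1V hregV (c₀ := c₀) (c₁ := c₁)) (exp (κ • (-MB)) f)) - (QkW L m n φ V hL α hα1 hU1V hregV (c₀ := c₀) (c₁ := c₁)) f‖ ≤ β * ‖f‖) ∧
      (∀ g, ‖exp (κ • MB) (LinearMap.adjoint (QkW L m n φ V hL α hα1 hU1V hregV (c₀ := c₀) (c₁ := c₁)) (exp (κ • (-MF)) g)) - LinearMap.adjoint (QkW L m n φ V hL α hα1 hU1V hregV (c₀ := c₀) (c₁ := c₁)) g‖ ≤ β * ‖g‖) ∧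
      (∀ f, ‖exp (κ • MB) (curvOp φ τ η V (exp (κ • (-MB)) f)) - curvOp φ τ η V f‖ ≤ βK * ‖f‖) ∧
      (∀ s, ‖exp (κ • MS) (RofUk L m n φ η V (c₀ := c₀) (exp (κ • (-MS)) s)) - RofUk L m n φ η V (c₀ := c₀) s‖ ≤ ρ * ‖s‖))
    (hPU : ∀ f, ‖covDivL2K ℂ c₀ ((η : ℂ))⁻¹ (adTransportW φ fun b => (U b)⁻¹) f - RofUk L m n φ η U (c₀ := c₀) (covDivL2K ℂ c₀ ((η : ℂ))⁻¹ (adTransportW φ fun b => (U b)⁻¹) f)‖ ≤ CP * ‖f‖)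
    (hPV : ∀ f, ‖covDivL2K ℂ c₀ ((η : ℂ))⁻¹ (adTransportW φ fun b => (V b)⁻¹) f - RofUk L m n φ η V (c₀ := c₀) (covDivL2K ℂ c₀ ((η : ℂ))⁻¹ (adTransportW φ fun b => (V b)⁻¹) f)‖ ≤ CP * ‖f‖)
    (small' : 3 / 4 * pK + (21 + 3 * a) * β ^ 2 + 4 * β * CP + 2 * ρ * CP ^ 2 + βK ≤ γ / 8)
    {δR δQ δK : ℝ} (hδR : 0 ≤ δR) (hδQ : 0 ≤ δQ) (hδK : 0 ≤ δK)
    (hT2 : ∀ (χ : TSite d (towerP L m (n + 1)) → ℝ) (χ' : TSite d m → ℝ),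
      (∀ b : Bond d (towerP L m (n + 1)), |χ (bpos b) - χ (btgt b)| ≤ ℓ * η) →
      (∀ (y : TSite d m) (x : TSite d (towerP L m (n + 1))),
        siteCast (towerP_eq_fineP_pow L m (n + 1)) x ∈ B9Eq319QprimeTorus.blockOf (L ^ (n + 1)) m y → |χ' y - χ x| ≤ ℓ') →
      ∀ (MB : BondL2K ℂ d (towerP L m (n + 1)) c₀ W →L[ℂ] BondL2K ℂ d (towerP L m (n + 1)) c₀ W),
      (∀ (g : BondL2K ℂ d (towerP L m (n + 1)) c₀ W) (b : Bond d (towerP L m (n + 1))),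
        WL2.equiv ℂ (fun _ : Bond d (towerP L m (n + 1)) => c₀) W (MB g) b = (χ (bpos b) : ℂ) • WL2.equiv ℂ (fun _ : Bond d (towerP L m (n + 1)) => c₀) W g b) →
      ∀ (MS : SiteL2K ℂ d (towerP L m (n + 1)) c₀ W →L[ℂ] SiteL2K ℂ d (towerP L m (n + 1)) c₀ W),
      (∀ (g : SiteL2K ℂ d (towerP L m (n + 1)) c₀ W) (x : TSite d (towerP L m (n + 1))),
        WL2.equiv ℂ (fun _ : TSite d (towerP L m (n + 1)) => c₀) W (MS g) x = (χ x : ℂ) • WL2.equiv ℂ (fun _ : TSite d (towerP L m (n + 1)) => c₀) W g x) →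
      ∀ (MF : BondL2K ℂ d m c₁ W →L[ℂ] BondL2K ℂ d m c₁ W),
      (∀ (g : BondL2K ℂ d m c₁ W) (b' : Bond d m),
        WL2.equiv ℂ (fun _ : Bond d m => c₁) W (MF g) b' = (χ' (bpos b') : ℂ) • WL2.equiv ℂ (fun _ : Bond d m => c₁) W g b') →
      ∀ κ : ℂ, ‖κ‖ = r →
      (∀ s, ‖exp (κ • MS) (RofUk L m n φ η V (c₀ := c₀) (exp (κ • (-MS)) s)) - exp (κ • MS) (RofUk L m n φ η U (c₀ := c₀) (exp (κ • (-MS)) s))‖ ≤ δR * ‖s‖) ∧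
      (∀ f, ‖exp (κ • MF) ((QkW L m n φ V hL α hα1 hU1V hregV (c₀ := c₀) (c₁ := c₁)) (exp (κ • (-MB)) f)) - exp (κ • MF) ((QkW L m n φ U hL α hα1 hU1U hregU (c₀ := c₀) (c₁ := c₁)) (exp (κ • (-MB)) f))‖ ≤ δQ * ‖f‖) ∧
      (∀ g, ‖exp (κ • MB) (LinearMap.adjoint (QkW L m n φ V hL α hα1 hU1V hregV (c₀ := c₀) (c₁ := c₁)) (exp (κ • (-MF)) g)) - exp (κ • MB) (LinearMap.adjoint (QkW L m n φ U hL α hα1 hU1U hregU (c₀ := c₀) (c₁ := c₁)) (exp (κ • (-MF)) g))‖ ≤ δQ * ‖g‖) ∧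
      (∀ f, ‖exp (κ • MB) (curvOp φ τ η V (exp (κ • (-MB)) f)) - exp (κ • MB) (curvOp φ τ η U (exp (κ • (-MB)) f))‖ ≤ δK * ‖f‖))
    -- the bond closeness of the two backgrounds, and the TREE's binders for the two Lipschitz letters `e_R`, `e_Q` (now DISCHARGED):
    {δ : ℝ} (hδ : 0 ≤ δ) (hUV : ∀ b, ‖(U b : 𝔸) - (V b : 𝔸)‖ ≤ δ * η)
    -- (3.16)'s weight relation, the bond smallness of both backgrounds, the common level profiles (`B9Eq325RLipschitzSqrtTowerTwoBackgroundsLinear`'s binders)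
    (hw : c₀ * ((L : ℝ) ^ (n + 1)) ^ d = c₁) {a' : ℝ} (ha' : 0 < a') {αb : ℝ} (hαb : 0 ≤ αb)
    (hUε : ∀ b, ‖(U b : 𝔸) - 1‖ ≤ αb * η) (hVε : ∀ b, ‖(V b : 𝔸) - 1‖ ≤ αb * η)
    (εU δUV : ℕ → ℝ) (hεU : ∀ j, 0 ≤ εU j) (hδUV : ∀ j, 0 ≤ δUV j)
    (hLεU : ∀ (j : ℕ) (b : Bond d (towerP L m (j + 1))), ‖(B9Eq315QTower.UlevOf L m (n + 1) U j b : 𝔸) - 1‖ ≤ εU j)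
    (hLεV : ∀ (j : ℕ) (b : Bond d (towerP L m (j + 1))), ‖(B9Eq315QTower.UlevOf L m (n + 1) V j b : 𝔸) - 1‖ ≤ εU j)
    (hLbU : ∀ (j : ℕ) (b : Bond d (towerP L m (j + 1))), B9Eq315QTower.UlevOf L m (n + 1) U j b ∈ U1 𝔸)
    (hLbV : ∀ (j : ℕ) (b : Bond d (towerP L m (j + 1))), B9Eq315QTower.UlevOf L m (n + 1) V j b ∈ U1 𝔸)
    (hLUV : ∀ (j : ℕ) (b : Bond d (towerP L m (j + 1))), ‖(B9Eq315QTower.UlevOf L m (n + 1) U j b : 𝔸) - (B9Eq315QTower.UlevOf L m (n + 1) V j b : 𝔸)‖ ≤ δUV j)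
    {rp α₀ δ₀ : ℝ} (hrp0 : 0 ≤ rp) (hrp1 : rp < 1) (hαα₀ : αb ≤ α₀) (hδ₀ : 0 < δ₀)
    (hεg : ∀ j < n + 1, εU j ≤ αb * rp ^ j) (hδg : ∀ j < n + 1, δUV j ≤ δ * rp ^ j)
    {sD sQ θb δbD γR θbG δbA sS sV s₂ sG₂ sA₂ : ℝ}
    (hsD : sD = Real.sqrt d * (2 * Mφ * Mφ'))
    (hsQ : sQ = 2 * (((d * (L - 1) : ℕ) : ℝ) * (2 * Mφ * Mφ') / (1 - rp)))
    (hθb : θb = sQ * α₀) (hδbD : δbD = sD * α₀)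
    (hγRdef : γR = 1 / (2 + 2 / a') - (δbD + δbD ^ 2 + a' * θb * (2 * 1 + θb)))
    (hθbG : θbG = 2 * δbD * (γR⁻¹ * (Real.sqrt γR)⁻¹) + (|a'| * θb * ((1 + θb) + 1)) * γR⁻¹ ^ 2)
    (hδbA : δbA = θbG * (1 + θb) + (2 + 2 / a') * θb)
    (hsS : sS = Real.sqrt (1 / (12 * (d : ℝ) * (6 / 5) ^ (d - 1) + a') ^ 2)) (hsV : sV = sS - δbA)
    (hs₂ : s₂ = 2 * Real.exp ((d * (L - 1) : ℕ) * (2 * Mφ * Mφ' * α₀ / (1 - rp))) *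
      ((d * (L - 1) : ℕ) * (2 * Mφ * Mφ') * (1 + 2 * Mφ * Mφ' * α₀) ^ (d * (L - 1)) / (1 - rp)))
    (hsG₂ : sG₂ = 2 * sD * (γR⁻¹ * (Real.sqrt γR)⁻¹) + (|a'| * s₂ * ((1 + θb) + (1 + θb))) * γR⁻¹ ^ 2)
    (hsA₂ : sA₂ = sG₂ * (1 + θb) + γR⁻¹ * s₂)
    (hc1 : ((d * (L - 1) : ℕ) : ℝ) * (2 * Mφ * Mφ') / (1 - rp) * α₀ ≤ 1) (hγR : 0 < γR) (hDγ : δbD ≤ 1 / (2 + 2 / a')) (hsV0 : 0 < sV)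
    (hB : ((d * (L - 1) : ℕ) * (2 * Mφ * Mφ') * (1 + 2 * Mφ * Mφ' * α₀) ^ (d * (L - 1)) / (1 - rp)) * δ₀ ≤ 1) (hwinR : 2 * sA₂ * δ₀ ≤ sV)
    -- `B9Eq315QTowerLipschitzL2TwoBackgroundsChain`'s extra binders (the `Q_k` letter)
    (hα128 : ∀ j, α j ≤ 1 / 128) (hδmax : ∀ j, δUV j ≤ 1 / (12288 * ((2 * (d * L) + L + L : ℕ) : ℝ)))
    (hwinQ : Real.sqrt ((L : ℝ) ^ d) * (Real.sqrt (2 * d) * (75497472 * ((d : ℝ) + 1) * ((2 * (d * L) + L + L : ℕ) : ℝ))) / (1 - rp) * δ ≤ 1)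
    (PB : TSite d m → BondL2K ℂ d (towerP L m (n + 1)) c₀ W →L[ℂ] BondL2K ℂ d (towerP L m (n + 1)) c₀ W)
    (hPB : ∀ (y : TSite d m) (f : BondL2K ℂ d (towerP L m (n + 1)) c₀ W) (b : Bond d (towerP L m (n + 1))),
      WL2.equiv ℂ (fun _ : Bond d (towerP L m (n + 1)) => c₀) W (PB y f) b =
        if blockCoord (L ^ (n + 1)) m (siteCast (towerP_eq_fineP_pow L m (n + 1)) (bpos b)) = y then
          WL2.equiv ℂ (fun _ : Bond d (towerP L m (n + 1)) => c₀) W f b else 0)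
    (y₀ y₁ : TSite d m) :
    ‖PB y₁ ∘L (LinearMap.toContinuousLinearMap (G1k L m n φ η V hL α hα1 hU1V hregV τ (c₀ := c₀) (c₁ := c₁) hposV) - LinearMap.toContinuousLinearMap (G1k L m n φ η U hL α hα1 hU1U hregU τ (c₀ := c₀) (c₁ := c₁) hposU)) ∘L PB y₀‖ ≤
      (((1 + β) * (4 * Real.exp (r * (ℓ * η)) * (Mφ * Mφ') * (d * Real.sqrt d) * δ) + (4 * Real.exp (r * (ℓ * η)) * (Mφ * Mφ') * (d * Real.sqrt d) * δ) * (1 + β) + (4 * Real.exp (r * (ℓ * η)) * (Mφ * Mφ') * (d * Real.sqrt d) * δ) * (4 * Real.exp (r * (ℓ * η)) * (Mφ * Mφ') * (d * Real.sqrt d) * δ)) +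
          ((1 + CP + β) * ((1 + ρ) * (2 * Real.exp (r * (ℓ * η)) * (Mφ * Mφ') * Real.sqrt d * δ) + δR * (1 + CP + β)) + (2 * Real.exp (r * (ℓ * η)) * (Mφ * Mφ') * Real.sqrt d * δ) * ((1 + ρ) * (1 + CP + β)) +
            (2 * Real.exp (r * (ℓ * η)) * (Mφ * Mφ') * Real.sqrt d * δ) * ((1 + ρ) * (2 * Real.exp (r * (ℓ * η)) * (Mφ * Mφ') * Real.sqrt d * δ) + δR * (1 + CP + β))) +
          δK + ((Real.sqrt a + |a| * β) * δQ + δQ * (Real.sqrt a + |a| * β) + |a| * (δQ * δQ))) / min (1 / 4) (γ / 8) *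
        ((1 + (8 * Real.sqrt d * (Mφ * Mφ') * δ + 2 * Mφ * Mφ' * δ * Real.sqrt d + (max (3 * sA₂ / sV) (2 / δ₀) * δ) * (1 + CP) + Real.sqrt a *
          (Mφ' * Mφ * Real.sqrt (c₁ / (c₀ * ((L : ℝ) ^ (n + 1)) ^ d)) * (2 * Real.exp (Real.sqrt ((L : ℝ) ^ d) * (Real.sqrt (2 * d) * (102 * (d + 1) ^ 2 * L)) * (αb / (1 - rp))) * (Real.sqrt ((L : ℝ) ^ d) * (Real.sqrt (2 * d) * (75497472 * ((d : ℝ) + 1) * ((2 * (d * L) + L + L : ℕ) : ℝ))) / (1 - rp) * δ))))) * (min (1 / 4) (γ / 8))⁻¹) * Real.exp r * Real.exp (-(r * tdist m y₀ y₁)) := by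
  have h1r : 0 < 1 - rp := by linarith
  have heR : 0 ≤ (max (3 * sA₂ / sV) (2 / δ₀) * δ) := mul_nonneg ((div_pos two_pos hδ₀).le.trans (le_max_right _ _)) hδ
  have heQ : 0 ≤ (Mφ' * Mφ * Real.sqrt (c₁ / (c₀ * ((L : ℝ) ^ (n + 1)) ^ d)) * (2 * Real.exp (Real.sqrt ((L : ℝ) ^ d) * (Real.sqrt (2 * d) * (102 * (d + 1) ^ 2 * L)) * (αb / (1 - rp))) * (Real.sqrt ((L : ℝ) ^ d) * (Real.sqrt (2 * d) * (75497472 * ((d : ℝ) + 1) * ((2 * (d * L) + L + L : ℕ) : ℝ))) / (1 - rp) * δ))) := by positivity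
  -- the two Lipschitz sockets, supplied by the TREE term-mode
  have uR : ∀ s : SiteL2K ℂ d (towerP L m (n + 1)) c₀ W, ‖RofUk L m n φ η U (c₀ := c₀) s - RofUk L m n φ η V (c₀ := c₀) s‖ ≤ (max (3 * sA₂ / sV) (2 / δ₀) * δ) * ‖s‖ :=
    fun s => norm_RofUk_sub_RofUk_le_diagonal_global L φ hMφ hMφ' hφ hφ' m n c₀ η c₁ ha' hηL hw U V hRSU hRSV hαb hδ hU hV hUε hVε hUV εU δUV hεU
      hδUV hLεU hLεV hLbU hLbV hLUV hrp0 hrp1 hαα₀ hεg hδg hsD hsQ hθb hδbD hγRdef hθbG hδbA hsS hsV hs₂ hsG₂ hsA₂ hc1 hγR hDγ hsV0 hB hwinR hδ₀ s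
  have uQ : ∀ f : BondL2K ℂ d (towerP L m (n + 1)) c₀ W,
      ‖(QkW L m n φ U hL α hα1 hU1U hregU (c₀ := c₀) (c₁ := c₁)) f - (QkW L m n φ V hL α hα1 hU1V hregV (c₀ := c₀) (c₁ := c₁)) f‖ ≤ (Mφ' * Mφ * Real.sqrt (c₁ / (c₀ * ((L : ℝ) ^ (n + 1)) ^ d)) * (2 * Real.exp (Real.sqrt ((L : ℝ) ^ d) * (Real.sqrt (2 * d) * (102 * (d + 1) ^ 2 * L)) * (αb / (1 - rp))) * (Real.sqrt ((L : ℝ) ^ d) * (Real.sqrt (2 * d) * (75497472 * ((d : ℝ) + 1) * ((2 * (d * L) + L + L : ℕ) : ℝ))) / (1 - rp) * δ))) * ‖f‖ :=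
    fun f => norm_QkW_sub_QkW_le_L2_linear L m n hL φ hMφ hMφ' hφ hφ' (c₀ := c₀) (c₁ := c₁) U V α hα1 hU1U hregU α hα1 hU1V hregV hα128 εU hεU hLεU hLεV
      δUV hδUV hδmax hLUV hrp0 hrp1 hαb hδ hεg hδg hwinQ f
  exact norm_block_G1k_sub_G1k_le φ hφ hφ' hMφ hMφ' hη hηL U V hU hV hRSU hRSV τ hL α hα1 hU1U hregU hU1V hregV a ha hm hposU hposV hγ hβ hℓ hℓ' hr hρ hρ8 hCP hcoerU hcoerV hKreU hKreV hwin hβCC hβC hβD hQKU hQKV hPU hPV small' hδR hδQ hδK hT2 hδ heR heQ hUV uR uQ PB hPB y₀ y₁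

end Literature.MathematicalPhysics.QuantumFieldTheory.Balaban1983to89.B9Eq326DeltaABlockDecayTowerTwoBackgroundsLipschitz

end
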